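import Summits.HodgeConjecture.HodgeConjecture.Theses.TropicalWeilObstruction
import Summits.HodgeConjecture.HodgeConjecture.Theorems.TropicalWeilObstructionTropicalHodgeBoundClassesEigenwave
import HarnessLib

/-!
# Route `TropicalWeilObstruction` (Kontsevich's tropical test — NEGATION SINK, exploration, no summit claim):
# transport of class tables along the Weil family — I. the congruence by `⋀⁴√Q`

Negation-sink bookkeeping of the cell `pub-hodge-tropical` (seat tropical-2 gen 5). Part I of two
(`…ClassPositivityTransport`, `…ClassPositivityAllPeriods`). K1 (`TropicalWeilVanishing`, stmt-18478) lives
at a very general Weil period `Q`; the kernel form of "class positivity is exhausted by the calibration cone"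
(K1-SCOPE §4B (P); tropical-1's `Kappa.boundaryRay_eq_sum_frameSquares`, p337681) is a statement at `Q = 1`,
its transport to other periods being prose ("congruence by `⋀⁴h`, `hᵀh = Q`"). This part builds the transport:

* `exists_sqrt_commuting_weilJ` — a positive definite `Q` commuting with `J` has a symmetric positive definite
  square root `h` commuting with `J` (`h = CFC.sqrt Q`, Mathlib's continuous functional calculus).
* `pushforward_frameSquare` — the congruence `C ↦ (1/4!)² Σ_{I,I'} det h[S,I] det h[S',I'] C(I,I')` (`⋀⁴h ⊗ ⋀⁴h`)
  maps the square `p_F ⊗ p_F` of the Plücker vector of a frame `F` to the square of the Plücker vector of the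
  REAL frame `h·F` (all-maps Cauchy–Binet); `pushforward_thetaClass_one` — it maps `θ₄(1)` to `θ₄(h·h)` for
  symmetric `h`; `pushforward_weilClassC_one` / `pushforward_weilClassRe_one` — it maps `w(1) = Ω ⊗ Ω` to
  `w(h·h)` for `h` commuting with `J` (`hΩ = Ω M_h`, `M_h M_h = M_{hh}`, `w(Q) = det M_Q · Ω ⊗ Ω`, p334819).

HONEST STATUS. Linear algebra (Mathlib + p334819); decides nothing about K1 or about the Hodge conjecture.
No definition, no named fact, no sorry.
References: [Zharkov2020TropicalWeil] I. Zharkov, Tropical abelian varieties, Weil classes and the Hodge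
conjecture, arXiv:2002.02347, §2 (pp. 2–4); [MikhalkinZharkov2014Eigenwave] G. Mikhalkin, I. Zharkov, Tropical
eigenwave and intermediate Jacobians, LN UMI 15 (2014), Prop. 4.3; Cauchy–Binet [folklore].
-/

set_option linter.dupNamespace false

noncomputable section

open scoped BigOperators MatrixOrder
open Matrix
open Literature.AlgebraicGeometry.Tropical
open Summit.HodgeConjecture.HodgeConjecture.Theorems.TropicalHodgeBound

namespace Summit.HodgeConjecture.HodgeConjecture.Theorems.TropicalWeilVanishing.Kappa

/-! ## §0 Display-only notation (the K3 skeleton's local definitions, verbatim bodies; nothing is defined) -/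

/-- `P = [1 | i·1]`, the `n × 2n` matrix of `dz₁ ∧ … ∧ dz_n`. -/
local notation3 (prettyPrint := false) "𝐏⟦" n "⟧" =>
  (Matrix.of fun (k : Fin n) (a : Fin (2 * n)) =>
    (if (a : ℕ) = (k : ℕ) then (1 : ℂ) else 0) + (if (a : ℕ) = (k : ℕ) + n then Complex.I else 0))

/-- The skeleton's `thetaClass n Q`. -/
local notation3 (prettyPrint := false) "θ⟦" n "⟧" Q:max =>
  (fun S S' : Fin n → Fin (2 * n) => Matrix.det (Matrix.submatrix Q S S'))

/-- The skeleton's `omegaFrame n` (`Ω = Pᴴ`). -/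
local notation3 (prettyPrint := false) "Ω⟦" n "⟧" =>
  (Matrix.of fun (a : Fin (2 * n)) (b : Fin n) =>
    (if (a : ℕ) = (b : ℕ) then (1 : ℂ) else 0) - (if (a : ℕ) = (b : ℕ) + n then Complex.I else 0))

/-- The skeleton's `weilClassC n Q` (`w(Q) = (⋀ⁿQ ⊗ 1)(Ω ⊗ Ω)`). -/
local notation3 (prettyPrint := false) "wC⟦" n "⟧" Q:max =>
  (fun S S' : Fin n → Fin (2 * n) =>
    Matrix.det (Matrix.submatrix (Matrix.map Q ((↑) : ℝ → ℂ) * Ω⟦n⟧) S id) *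
      Matrix.det (Matrix.submatrix (Ω⟦n⟧) S' id))

/-- The skeleton's `weilClassRe n Q` (`w₁ = Re w`). -/
local notation3 (prettyPrint := false) "wRe⟦" n "⟧" Q:max =>
  (fun S S' : Fin n → Fin (2 * n) => Complex.re ((wC⟦n⟧ Q) S S'))

/-- `M_Q := ½ · P Q Pᴴ`, the matrix of `Q|_{V^{1,0}}` in the frame `Ω` (`QΩ = Ω M_Q`). Nothing is defined. -/
local notation3 (prettyPrint := false) "𝐌⟦" n "⟧" Q:max =>
  ((2 : ℂ)⁻¹ • (𝐏⟦n⟧ * Matrix.map Q ((↑) : ℝ → ℂ) * (𝐏⟦n⟧)ᴴ))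

/-- NEW display-only notation: the square `p_F ⊗ p_F` of the Plücker vector `p_F(S) = det F[S,·]` of a REAL
`8 × 4` matrix `F`, as a real table on word pairs. Nothing is defined. -/
local notation3 (prettyPrint := false) "sq⟦" F "⟧" =>
  (fun S S' : Fin 4 → Fin (2 * 4) =>
    Matrix.det (Matrix.submatrix F S id) * Matrix.det (Matrix.submatrix F S' id))

/-! ## §1 A symmetric square root of the period commuting with `J` -/

/-- **A Weil period has a Weil square root.** A positive definite real matrix `Q` commuting with `J` has a
symmetric positive definite square root `h` (`h·h = Q`) commuting with `J`: `h = √Q` by the continuous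
functional calculus (a limit of polynomials in `Q`). [folklore] -/
theorem exists_sqrt_commuting_weilJ (Q : Matrix (Fin (2 * 4)) (Fin (2 * 4)) ℝ) (hQ : Q.PosDef)
    (hJ : Q * weilJ 4 = weilJ 4 * Q) :
    ∃ h : Matrix (Fin (2 * 4)) (Fin (2 * 4)) ℝ,
      h.PosDef ∧ h * h = Q ∧ h * weilJ 4 = weilJ 4 * h ∧ hᵀ = h := by
  have hQ0 : (0 : Matrix (Fin (2 * 4)) (Fin (2 * 4)) ℝ) ≤ Q := hQ.posSemidef.nonneg
  have h1 : (CFC.sqrt Q).PosSemidef := (CFC.sqrt_nonneg Q).posSemidef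
  refine ⟨CFC.sqrt Q, ?_, CFC.sqrt_mul_sqrt_self Q hQ0, ?_, ?_⟩
  · rw [Matrix.PosSemidef.posDef_iff_isUnit h1, CFC.isUnit_sqrt_iff Q hQ0]
    exact hQ.isUnit
  · have hc : Commute Q (weilJ 4) := hJ
    have h2 := hc.cfc_nnreal NNReal.sqrt
    rwa [← CFC.sqrt_eq_cfc] at h2
  · have h3 := h1.isHermitian
    rw [Matrix.IsHermitian, Matrix.conjTranspose_eq_transpose_of_trivial] at h3
    exact h3

/-! ## §2 The congruence by `⋀⁴h` on frame squares, on `θ₄(1)` and on `Re w(1)` -/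

/-- Plücker vector of the pushed frame: `det (h·F)[S,·] = (1/4!) Σ_I det h[S,I] · det F[I,·]` (all-maps
Cauchy–Binet). [folklore] -/
theorem det_submatrix_mul_eq_sum {R : Type*} [CommRing R] (h : Matrix (Fin (2 * 4)) (Fin (2 * 4)) R)
    (F : Matrix (Fin (2 * 4)) (Fin 4) R) (S : Fin 4 → Fin (2 * 4)) :
    (24 : R) * ((h * F).submatrix S id).det =
      ∑ I : Fin 4 → Fin (2 * 4), (h.submatrix S I).det * (F.submatrix I id).det := by
  have hcb := sum_det_submatrix_mul_det_submatrix (h.submatrix S id) F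
  simp only [Matrix.submatrix_submatrix, Function.comp_id, Function.id_comp] at hcb
  rw [hcb, Matrix.submatrix_mul h F S id id Function.bijective_id, Matrix.submatrix_id_id]
  norm_num [Nat.factorial]

/-- **Push-forward of a frame square is the square of the pushed frame:**
`(1/4!)² Σ_{I,I'} det h[S,I] det h[S',I'] · p_F(I) p_F(I') = p_{hF}(S) p_{hF}(S')`. [folklore] -/
theorem pushforward_frameSquare (h : Matrix (Fin (2 * 4)) (Fin (2 * 4)) ℝ)
    (F : Matrix (Fin (2 * 4)) (Fin 4) ℝ) (S S' : Fin 4 → Fin (2 * 4)) :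
    ∑ I : Fin 4 → Fin (2 * 4), ∑ I' : Fin 4 → Fin (2 * 4),
        (h.submatrix S I).det * (h.submatrix S' I').det * (sq⟦F⟧ I I') =
      (576 : ℝ) * sq⟦h * F⟧ S S' := by
  have e : (576 : ℝ) * sq⟦h * F⟧ S S' =
      ((24 : ℝ) * ((h * F).submatrix S id).det) * ((24 : ℝ) * ((h * F).submatrix S' id).det) := by ring
  rw [e, det_submatrix_mul_eq_sum, det_submatrix_mul_eq_sum, Finset.sum_mul_sum]
  refine Finset.sum_congr rfl fun I _ => Finset.sum_congr rfl fun I' _ => ?_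
  ring

/-- For a symmetric `h`: `det h[S,I] = det h[I,S]`. [folklore] -/
theorem det_submatrix_swap_of_transpose_eq (h : Matrix (Fin (2 * 4)) (Fin (2 * 4)) ℝ) (hT : hᵀ = h)
    (S I : Fin 4 → Fin (2 * 4)) : (h.submatrix S I).det = (h.submatrix I S).det := by
  conv_lhs => rw [← hT]
  rw [← Matrix.transpose_submatrix, Matrix.det_transpose]

/-- **Push-forward of `θ₄(1)` is `θ₄(h²)`:** `(1/4!)² Σ_{I,I'} det h[S,I] det h[S',I'] det 1[I,I'] = det (h·h)[S,S']`
for symmetric `h`. [folklore] -/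
theorem pushforward_thetaClass_one (h : Matrix (Fin (2 * 4)) (Fin (2 * 4)) ℝ) (hT : hᵀ = h)
    (S S' : Fin 4 → Fin (2 * 4)) :
    ∑ I : Fin 4 → Fin (2 * 4), ∑ I' : Fin 4 → Fin (2 * 4),
        (h.submatrix S I).det * (h.submatrix S' I').det *
          ((1 : Matrix (Fin (2 * 4)) (Fin (2 * 4)) ℝ).submatrix I I').det =
      (576 : ℝ) * ((h * h).submatrix S S').det := by
  -- inner sum over `I'`: `Σ_{I'} det h[S',I'] det 1[I,I'] = 24 det h[S',I]`
  have hinner : ∀ I : Fin 4 → Fin (2 * 4),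
      ∑ I' : Fin 4 → Fin (2 * 4), (h.submatrix S' I').det *
          ((1 : Matrix (Fin (2 * 4)) (Fin (2 * 4)) ℝ).submatrix I I').det = 24 * (h.submatrix S' I).det := by
    intro I
    have hcb := det_submatrix_mul_eq_sum h ((1 : Matrix (Fin (2 * 4)) (Fin (2 * 4)) ℝ).submatrix id I) S'
    have hmul : h * ((1 : Matrix (Fin (2 * 4)) (Fin (2 * 4)) ℝ).submatrix id I) = h.submatrix id I := by
      ext a b
      simp [Matrix.mul_apply, Matrix.submatrix_apply, Matrix.one_apply]
    rw [hmul, show (h.submatrix id I).submatrix S' id = h.submatrix S' I from rfl] at hcb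
    rw [hcb]
    refine Finset.sum_congr rfl fun I' _ => ?_
    congr 1
    rw [show ((1 : Matrix (Fin (2 * 4)) (Fin (2 * 4)) ℝ).submatrix id I).submatrix I' id =
        (((1 : Matrix (Fin (2 * 4)) (Fin (2 * 4)) ℝ).submatrix I I')ᵀ) from by
          ext a b; simp [Matrix.transpose_apply, Matrix.submatrix_apply, Matrix.one_apply, eq_comm],
      Matrix.det_transpose]
  calc ∑ I : Fin 4 → Fin (2 * 4), ∑ I' : Fin 4 → Fin (2 * 4),
        (h.submatrix S I).det * (h.submatrix S' I').det *
          ((1 : Matrix (Fin (2 * 4)) (Fin (2 * 4)) ℝ).submatrix I I').det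
      = ∑ I : Fin 4 → Fin (2 * 4), (h.submatrix S I).det *
          ∑ I' : Fin 4 → Fin (2 * 4), (h.submatrix S' I').det *
            ((1 : Matrix (Fin (2 * 4)) (Fin (2 * 4)) ℝ).submatrix I I').det := by
        refine Finset.sum_congr rfl fun I _ => ?_
        rw [Finset.mul_sum]
        exact Finset.sum_congr rfl fun I' _ => by ring
    _ = 24 * ∑ I : Fin 4 → Fin (2 * 4), (h.submatrix I S).det * (h.submatrix I S').det := by
        rw [Finset.mul_sum]
        refine Finset.sum_congr rfl fun I _ => ?_
        rw [hinner I, det_submatrix_swap_of_transpose_eq h hT S I, det_submatrix_swap_of_transpose_eq h hT S' I]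
        ring
    _ = (576 : ℝ) * ((h * h).submatrix S S').det := by
        have h24 := det_submatrix_transpose_mul_self_eq_sum h S S'
        rw [hT] at h24
        rw [← h24]
        ring

/-- `M_1 = 1` (`½ P Pᴴ = 1`). [folklore] -/
theorem M_one : 𝐌⟦4⟧ (1 : Matrix (Fin (2 * 4)) (Fin (2 * 4)) ℝ) = 1 := by
  have hmap : (1 : Matrix (Fin (2 * 4)) (Fin (2 * 4)) ℝ).map ((↑) : ℝ → ℂ) = 1 :=
    Matrix.map_one _ Complex.ofReal_zero Complex.ofReal_one
  rw [hmap, Matrix.mul_one, frame_mul_frame_conjTranspose, smul_smul]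
  norm_num

/-- **`M_h · M_h = M_{h·h}`** for `h` commuting with `J` (`hΩ = Ω M_h` twice, `PΩ = 2`).
[cite: Zharkov2020TropicalWeil, §2] -/
theorem M_mul_M_eq (h : Matrix (Fin (2 * 4)) (Fin (2 * 4)) ℝ) (hJ : h * weilJ 4 = weilJ 4 * h) :
    𝐌⟦4⟧ h * 𝐌⟦4⟧ h = 𝐌⟦4⟧ (h * h) := by
  have hJ2 : (h * h) * weilJ 4 = weilJ 4 * (h * h) := by
    rw [Matrix.mul_assoc, hJ, ← Matrix.mul_assoc, hJ, Matrix.mul_assoc]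
  have hhmap : (h * h).map ((↑) : ℝ → ℂ) = h.map ((↑) : ℝ → ℂ) * h.map ((↑) : ℝ → ℂ) :=
    Matrix.map_mul (f := Complex.ofRealHom)
  have frame_mul_omega : 𝐏⟦4⟧ * Ω⟦4⟧ = (2 : ℂ) • (1 : Matrix (Fin 4) (Fin 4) ℂ) := by
    rw [← frame_conjTranspose_eq]; exact frame_mul_frame_conjTranspose
  -- `Ω M_{hh} = (hh)Ω = h(hΩ) = hΩM_h = Ω M_h M_h`
  have hΩ : Ω⟦4⟧ * 𝐌⟦4⟧ (h * h) = Ω⟦4⟧ * (𝐌⟦4⟧ h * 𝐌⟦4⟧ h) := by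
    calc Ω⟦4⟧ * 𝐌⟦4⟧ (h * h) = (h * h).map ((↑) : ℝ → ℂ) * Ω⟦4⟧ := (map_mul_omega_eq_omega_mul (h * h) hJ2).symm
      _ = h.map ((↑) : ℝ → ℂ) * (h.map ((↑) : ℝ → ℂ) * Ω⟦4⟧) := by rw [hhmap, Matrix.mul_assoc]
      _ = h.map ((↑) : ℝ → ℂ) * (Ω⟦4⟧ * 𝐌⟦4⟧ h) := by rw [map_mul_omega_eq_omega_mul h hJ]
      _ = (h.map ((↑) : ℝ → ℂ) * Ω⟦4⟧) * 𝐌⟦4⟧ h := (Matrix.mul_assoc _ _ _).symm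
      _ = (Ω⟦4⟧ * 𝐌⟦4⟧ h) * 𝐌⟦4⟧ h := by rw [map_mul_omega_eq_omega_mul h hJ]
      _ = Ω⟦4⟧ * (𝐌⟦4⟧ h * 𝐌⟦4⟧ h) := Matrix.mul_assoc _ _ _
  have hP : (2 : ℂ) • 𝐌⟦4⟧ (h * h) = (2 : ℂ) • (𝐌⟦4⟧ h * 𝐌⟦4⟧ h) := by
    calc (2 : ℂ) • 𝐌⟦4⟧ (h * h) = ((2 : ℂ) • (1 : Matrix (Fin 4) (Fin 4) ℂ)) * 𝐌⟦4⟧ (h * h) := by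
          rw [Matrix.smul_mul, Matrix.one_mul]
      _ = 𝐏⟦4⟧ * (Ω⟦4⟧ * 𝐌⟦4⟧ (h * h)) := by rw [← frame_mul_omega, Matrix.mul_assoc]
      _ = 𝐏⟦4⟧ * (Ω⟦4⟧ * (𝐌⟦4⟧ h * 𝐌⟦4⟧ h)) := by rw [hΩ]
      _ = (2 : ℂ) • (𝐌⟦4⟧ h * 𝐌⟦4⟧ h) := by rw [← Matrix.mul_assoc, frame_mul_omega, Matrix.smul_mul, Matrix.one_mul]
  exact (smul_right_injective _ (two_ne_zero' ℂ) hP).symm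

/-- Pushed `Ω`-minor: `(1/4!) Σ_I det h[S,I] · Ω(I) = det M_h · Ω(S)` for `h` commuting with `J`
(`hΩ = Ω M_h`). [cite: Zharkov2020TropicalWeil, §2] -/
theorem sum_det_submatrix_mul_omega (h : Matrix (Fin (2 * 4)) (Fin (2 * 4)) ℝ)
    (hJ : h * weilJ 4 = weilJ 4 * h) (S : Fin 4 → Fin (2 * 4)) :
    ∑ I : Fin 4 → Fin (2 * 4), (((h.submatrix S I).det : ℝ) : ℂ) * ((Ω⟦4⟧).submatrix I id).det =
      24 * ((𝐌⟦4⟧ h).det * ((Ω⟦4⟧).submatrix S id).det) := by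
  have hcb := det_submatrix_mul_eq_sum (h.map ((↑) : ℝ → ℂ)) (Ω⟦4⟧) S
  have hcast : ∀ I : Fin 4 → Fin (2 * 4),
      (((h.submatrix S I).det : ℝ) : ℂ) = ((h.map ((↑) : ℝ → ℂ)).submatrix S I).det := by
    intro I; rw [ofReal_det]; rfl
  simp_rw [hcast]
  rw [← hcb, map_mul_omega_eq_omega_mul h hJ,
    show (Ω⟦4⟧ * 𝐌⟦4⟧ h).submatrix S id = (Ω⟦4⟧).submatrix S id * 𝐌⟦4⟧ h from rfl, Matrix.det_mul]
  ring

/-- **Push-forward of `w(1) = Ω ⊗ Ω` is `w(h·h)`** for `h` commuting with `J`: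
`(1/4!)² Σ_{I,I'} det h[S,I] det h[S',I'] · w(1)(I,I') = w(h·h)(S,S')`. [cite: Zharkov2020TropicalWeil, §2] -/
theorem pushforward_weilClassC_one (h : Matrix (Fin (2 * 4)) (Fin (2 * 4)) ℝ)
    (hJ : h * weilJ 4 = weilJ 4 * h) (S S' : Fin 4 → Fin (2 * 4)) :
    ∑ I : Fin 4 → Fin (2 * 4), ∑ I' : Fin 4 → Fin (2 * 4),
        (((h.submatrix S I).det : ℝ) : ℂ) * (((h.submatrix S' I').det : ℝ) : ℂ) *
          (wC⟦4⟧ (1 : Matrix (Fin (2 * 4)) (Fin (2 * 4)) ℝ)) I I' =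
      (576 : ℂ) * (wC⟦4⟧ (h * h)) S S' := by
  have h1J : (1 : Matrix (Fin (2 * 4)) (Fin (2 * 4)) ℝ) * weilJ 4 = weilJ 4 * 1 := by
    rw [Matrix.one_mul, Matrix.mul_one]
  have hJ2 : (h * h) * weilJ 4 = weilJ 4 * (h * h) := by
    rw [Matrix.mul_assoc, hJ, ← Matrix.mul_assoc, hJ, Matrix.mul_assoc]
  have hw1 : ∀ I I' : Fin 4 → Fin (2 * 4), (wC⟦4⟧ (1 : Matrix (Fin (2 * 4)) (Fin (2 * 4)) ℝ)) I I' =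
      ((Ω⟦4⟧).submatrix I id).det * ((Ω⟦4⟧).submatrix I' id).det := by
    intro I I'
    rw [weilClassC_eq_det_mul 1 h1J I I', M_one, Matrix.det_one, one_mul]
  simp_rw [hw1]
  calc ∑ I : Fin 4 → Fin (2 * 4), ∑ I' : Fin 4 → Fin (2 * 4),
        (((h.submatrix S I).det : ℝ) : ℂ) * (((h.submatrix S' I').det : ℝ) : ℂ) *
          (((Ω⟦4⟧).submatrix I id).det * ((Ω⟦4⟧).submatrix I' id).det)
      = (∑ I : Fin 4 → Fin (2 * 4), (((h.submatrix S I).det : ℝ) : ℂ) * ((Ω⟦4⟧).submatrix I id).det) *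
          (∑ I' : Fin 4 → Fin (2 * 4), (((h.submatrix S' I').det : ℝ) : ℂ) * ((Ω⟦4⟧).submatrix I' id).det) := by
        rw [Finset.sum_mul_sum]
        refine Finset.sum_congr rfl fun I _ => Finset.sum_congr rfl fun I' _ => ?_
        ring
    _ = (24 * ((𝐌⟦4⟧ h).det * ((Ω⟦4⟧).submatrix S id).det)) *
          (24 * ((𝐌⟦4⟧ h).det * ((Ω⟦4⟧).submatrix S' id).det)) := by
        rw [sum_det_submatrix_mul_omega h hJ S, sum_det_submatrix_mul_omega h hJ S']
    _ = (576 : ℂ) * (((𝐌⟦4⟧ h).det * (𝐌⟦4⟧ h).det) *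
          (((Ω⟦4⟧).submatrix S id).det * ((Ω⟦4⟧).submatrix S' id).det)) := by ring
    _ = (576 : ℂ) * (wC⟦4⟧ (h * h)) S S' := by
        rw [← Matrix.det_mul, M_mul_M_eq h hJ, weilClassC_eq_det_mul (h * h) hJ2 S S']

/-- Real part of the previous identity: the push-forward of `Re w(1)` is `Re w(h·h)`.
[cite: Zharkov2020TropicalWeil, §2] -/
theorem pushforward_weilClassRe_one (h : Matrix (Fin (2 * 4)) (Fin (2 * 4)) ℝ)
    (hJ : h * weilJ 4 = weilJ 4 * h) (S S' : Fin 4 → Fin (2 * 4)) :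
    ∑ I : Fin 4 → Fin (2 * 4), ∑ I' : Fin 4 → Fin (2 * 4),
        (h.submatrix S I).det * (h.submatrix S' I').det *
          (wRe⟦4⟧ (1 : Matrix (Fin (2 * 4)) (Fin (2 * 4)) ℝ)) I I' =
      (576 : ℝ) * (wRe⟦4⟧ (h * h)) S S' := by
  have hc := congrArg Complex.re (pushforward_weilClassC_one h hJ S S')
  rw [Complex.re_sum] at hc
  simp_rw [Complex.re_sum] at hc
  have lhs : ∀ I I' : Fin 4 → Fin (2 * 4),
      ((((h.submatrix S I).det : ℝ) : ℂ) * (((h.submatrix S' I').det : ℝ) : ℂ) *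
          (wC⟦4⟧ (1 : Matrix (Fin (2 * 4)) (Fin (2 * 4)) ℝ)) I I').re =
        (h.submatrix S I).det * (h.submatrix S' I').det *
          (wRe⟦4⟧ (1 : Matrix (Fin (2 * 4)) (Fin (2 * 4)) ℝ)) I I' := by
    intro I I'
    rw [← Complex.ofReal_mul, Complex.re_ofReal_mul]
  simp_rw [lhs] at hc
  rw [hc]
  have e : ((576 : ℂ) * (wC⟦4⟧ (h * h)) S S').re = 576 * ((wC⟦4⟧ (h * h)) S S').re := by
    rw [show (576 : ℂ) = ((576 : ℝ) : ℂ) by norm_num, Complex.re_ofReal_mul]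
  exact e

end Summit.HodgeConjecture.HodgeConjecture.Theorems.TropicalWeilVanishing.Kappa

end
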